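import Mathlib.RepresentationTheory.Homological.GroupCohomology.LowDegree
import Mathlib.LinearAlgebra.Matrix.GeneralLinearGroup.Defs
import Mathlib.Algebra.Field.ZMod

/-!
# Sah's lemma (`H¹(G, A) = 0` when a central element acts by a scalar `c` with `c - 1` invertible) and the
# finite core of Howard's hypothesis H.2 at `p = 3`: `H¹(GL₂(𝔽₃), 𝔽₃²) = 0`

Support algebra for the crux `TwinAlgMuZeroAtThree` (stmt-BirchSwinnertonDyer-24254), Kolyvagin-system road
(`Cruxes/TwinAlgMuZeroAtThree/Ideas/local-indivisibility-road.md`, audit `AuditKSHypothesesAtThree-g53.md` Δ1, typed handle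
`H1StdVanishes` of `SketchUtdIdeaG53.lean`): Howard's H.2 asks `H¹(K(E′[3^∞])/K, E′[3]) = 0`; by inflation–restriction its
finite core is `H¹(GL₂(𝔽₃), 𝔽₃²) = 0`, which holds because the CENTRAL involution `-1` acts by `-1` and `-1 - 1 = -2` is a
unit of `𝔽₃` (Sah's lemma). We prove Sah's lemma for any `k`-linear representation (`sah_subsingleton_H1`: a 1-cocycle `f`
satisfies `(c - 1) • f(g) = ρ(g) f(z) - f(z)`, so `f = ∂((c - 1)⁻¹ • f(z))` is a coboundary) and the instance
`subsingleton_H1_GL2_zmod3_std` (= `H1StdVanishes`, with the standard representation spelled out). APPENDED (same seat):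
`noStdConstituentInAdjoint` (= g53's `NoStdConstituentInAdjoint`, `std` spelled out): no equivariant surjection from a
conjugation-stable subspace of `M₂(𝔽₃)` onto `𝔽₃²` — the same central-involution trick (conjugation by `-1` is trivial on matrices). THEOREMS ONLY; no
`sorry`. References: C.-H. Sah, *Automorphisms of finite groups*, J. Algebra 10 (1968) (the lemma, folklore form as in
Lang, *Algebra*, or Rubin, *Euler Systems*, Lemma A.2 type statements); B. Howard, Compositio 140 (2004), hypotheses H.1–H.2.
-/

set_option linter.dupNamespace false
set_option autoImplicit false

noncomputable section

namespace Summit.BirchSwinnertonDyer.BirchSwinnertonDyer.Theorems.UniversalToricDescentCentralElementH1Vanishing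

open groupCohomology CategoryTheory

universe u

/-- **Sah's lemma (cocycle form).** Let `z ∈ G` be central and act on the `k[G]`-module `A` by the scalar `c`. Then every
1-cocycle `f` satisfies `(c - 1) • f g = ρ(g) (f z) - f z` for all `g`. [folklore] -/
theorem sub_one_smul_apply_eq_of_central {k G : Type u} [CommRing k] [Group G] {A : Rep k G} {z : G}
    (hz : ∀ g : G, g * z = z * g) {c : k} (hρ : ∀ a : A, A.ρ z a = c • a) (f : cocycles₁ A) (g : G) :
    (c - 1) • f g = A.ρ g (f z) - f z := by
  have h1 : f (g * z) = A.ρ g (f z) + f g := (mem_cocycles₁_iff f).1 f.2 g z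
  have h2 : f (z * g) = A.ρ z (f g) + f z := (mem_cocycles₁_iff f).1 f.2 z g
  rw [hz g, h2, hρ] at h1
  -- `c • f g + f z = ρ g (f z) + f g`
  rw [sub_smul, one_smul]
  calc c • f g - f g = (c • f g + f z) - f z - f g := by abel
    _ = (A.ρ g (f z) + f g) - f z - f g := by rw [h1]
    _ = A.ρ g (f z) - f z := by abel

/-- **Sah's lemma.** If a central element `z ∈ G` acts on `A` by a scalar `c` with `c - 1` a unit, then `H¹(G, A) = 0`:
every 1-cocycle is the coboundary of `(c - 1)⁻¹ • f z`. [folklore] -/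
theorem sah_subsingleton_H1 {k G : Type u} [CommRing k] [Group G] (A : Rep k G) {z : G}
    (hz : ∀ g : G, g * z = z * g) {c : k} (hc : IsUnit (c - 1)) (hρ : ∀ a : A, A.ρ z a = c • a) :
    Subsingleton (H1 A) := by
  obtain ⟨u, hu⟩ := hc
  refine ⟨fun x y => ?_⟩
  have hzero : ∀ x : H1 A, x = 0 := by
    intro x
    induction x using H1_induction_on with
    | h f =>
      rw [H1π_eq_zero_iff]
      -- `f = ∂ ((c - 1)⁻¹ • f z)`
      refine ⟨(↑u⁻¹ : k) • f z, funext fun g => ?_⟩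
      rw [d₀₁_hom_apply, map_smul, ← smul_sub, ← sub_one_smul_apply_eq_of_central hz hρ f g, ← hu, smul_smul,
        Units.inv_mul, one_smul]
  rw [hzero x, hzero y]

/-- **`H¹(GL₂(𝔽₃), 𝔽₃²) = 0`** for the standard representation (finite core of Howard's H.2 at `p = 3` under mod-`3`
surjectivity; = `H1StdVanishes` of the utd-idea g53 audit, the representation `std` spelled out): the central involution
`-1` acts by `-1`, and `-1 - 1` is a unit of `𝔽₃`. [folklore] -/
theorem subsingleton_H1_GL2_zmod3_std :
    Subsingleton (H1 (Rep.of ((Units.coeHom ((Fin 2 → ZMod 3) →ₗ[ZMod 3] (Fin 2 → ZMod 3))).comp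
      (Matrix.GeneralLinearGroup.toLin.toMonoidHom :
        GL (Fin 2) (ZMod 3) →* ((Fin 2 → ZMod 3) →ₗ[ZMod 3] (Fin 2 → ZMod 3))ˣ)))) := by
  refine sah_subsingleton_H1 _ (z := -1) (fun g => by rw [mul_neg_one, neg_one_mul]) (c := -1) ?_ ?_
  · exact isUnit_iff_exists_inv.mpr ⟨1, by decide⟩
  · intro v
    ext i
    simp [Matrix.GeneralLinearGroup.toLin]


/-- **No standard constituent in the adjoint module, equivariant-surjection form** (= `NoStdConstituentInAdjoint` of the utd-idea g53
audit, the representation `std` spelled out): there is NO `GL₂(𝔽₃)`-equivariant `𝔽₃`-linear SURJECTION from a conjugation-stable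
subspace `W ⊆ M₂(𝔽₃)` onto the standard module `𝔽₃²`. Reason (the same central-element trick as Sah's lemma): conjugation by the
central involution `-1` is trivial on `M₂(𝔽₃)` but `-1` acts by `-1` on `𝔽₃²`, so an equivariant `f` satisfies `f X = -f X`, i.e.
`f = 0` (as `2` is a unit of `𝔽₃`), which is not onto `𝔽₃² ≠ 0`. (This is the Frattini-layer statement behind the pro-`3` step of
Howard's H.2 at `p = 3`: no subquotient of `ker(GL₂(ℤ₃) → GL₂(𝔽₃))^{ab} ⊗ 𝔽₃ ⊆ M₂(𝔽₃)` is the standard module.) [folklore] -/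
theorem noStdConstituentInAdjoint :
    ∀ (W : Submodule (ZMod 3) (Matrix (Fin 2) (Fin 2) (ZMod 3)))
      (hW : ∀ g : GL (Fin 2) (ZMod 3), ∀ X ∈ W, (g : Matrix (Fin 2) (Fin 2) (ZMod 3)) * X *
        ((g⁻¹ : GL (Fin 2) (ZMod 3)) : Matrix (Fin 2) (Fin 2) (ZMod 3)) ∈ W)
      (f : W →ₗ[ZMod 3] (Fin 2 → ZMod 3)),
      (∀ g : GL (Fin 2) (ZMod 3), ∀ X : W,
        f ⟨(g : Matrix (Fin 2) (Fin 2) (ZMod 3)) * (X : Matrix (Fin 2) (Fin 2) (ZMod 3)) *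
          ((g⁻¹ : GL (Fin 2) (ZMod 3)) : Matrix (Fin 2) (Fin 2) (ZMod 3)), hW g X X.2⟩ =
          ((Units.coeHom ((Fin 2 → ZMod 3) →ₗ[ZMod 3] (Fin 2 → ZMod 3))).comp
            (Matrix.GeneralLinearGroup.toLin.toMonoidHom :
              GL (Fin 2) (ZMod 3) →* ((Fin 2 → ZMod 3) →ₗ[ZMod 3] (Fin 2 → ZMod 3))ˣ)) g (f X)) →
      ¬ Function.Surjective f := by
  intro W hW f hf hsurj
  -- conjugation by the central `-1` is the identity on `W`
  have hconj : ∀ X : W,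
      (⟨((-1 : GL (Fin 2) (ZMod 3)) : Matrix (Fin 2) (Fin 2) (ZMod 3)) * (X : Matrix (Fin 2) (Fin 2) (ZMod 3)) *
        (((-1 : GL (Fin 2) (ZMod 3))⁻¹ : GL (Fin 2) (ZMod 3)) : Matrix (Fin 2) (Fin 2) (ZMod 3)), hW (-1) X X.2⟩ : W) = X := by
    intro X
    apply Subtype.ext
    simp
  -- but `-1` acts by `-1` on `𝔽₃²`, so `f X = -f X`
  have hS : ∀ v : Fin 2 → ZMod 3,
      ((Units.coeHom ((Fin 2 → ZMod 3) →ₗ[ZMod 3] (Fin 2 → ZMod 3))).comp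
        (Matrix.GeneralLinearGroup.toLin.toMonoidHom :
          GL (Fin 2) (ZMod 3) →* ((Fin 2 → ZMod 3) →ₗ[ZMod 3] (Fin 2 → ZMod 3))ˣ)) (-1) v = -v := by
    intro v
    ext i
    simp [Matrix.GeneralLinearGroup.toLin]
  have hneg : ∀ X : W, f X = -f X := by
    intro X
    have h := hf (-1) X
    rw [hconj X, hS] at h
    exact h
  have hzero : ∀ X : W, f X = 0 := by
    intro X
    have h2 : (2 : ZMod 3) • f X = 0 := by
      rw [two_smul]
      nth_rewrite 2 [hneg X]
      rw [add_neg_cancel]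
    have hu : IsUnit (2 : ZMod 3) := isUnit_iff_exists_inv.mpr ⟨2, by decide⟩
    exact (hu.smul_eq_zero).mp h2
  -- hence `f` is not onto: `(1, 0)` is not hit
  obtain ⟨X, hX⟩ := hsurj (fun _ => 1)
  rw [hzero X] at hX
  have := congr_fun hX 0
  simp at this

end Summit.BirchSwinnertonDyer.BirchSwinnertonDyer.Theorems.UniversalToricDescentCentralElementH1Vanishing

end
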